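import Summits.BirchSwinnertonDyer.BirchSwinnertonDyer.Theorems.SignedLowerHalvesSmallImageLowerHalfBothSignsLambdaLowerThreeNsThetaPartnerSharpExport
import Summits.BirchSwinnertonDyer.BirchSwinnertonDyer.Theorems.SignedLowerHalvesSmallImageLowerHalfBothSignsLambdaLowerThreeNsThetaPartnerSharpSymm
import HarnessLib

/-!
# K0₂‴ — the arithmetic half with a SHARP, `Aut(K/ℚ)`-STABLE modulus: producer‴ = the EXPORT CONTRACT of RULING «SHARP-1» §1 verbatim
# (crux L `SmallImageLowerHalfBothSigns`, stmt-BirchSwinnertonDyer-23599, line `rtt_w3` v45)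

INPUTS hand `bsd-inputs-honda-p1` g32 under LEAD `cruxlead-stmt-BirchSwinnertonDyer-23599` g16 (crux dir `Lines/rtt_w3-BRIEF-SHARP-g16.md` §1); helper
`--supports stmt-BirchSwinnertonDyer-23599`; THEOREMS ONLY, no `sorry`; additive (producer′ `…SharpExport`, p830355, is not edited). BSD is not proved here;
the inputs typed/proved here make the conditional line unconditional AS TYPED only.

WHY. Producer′ (`exists_arithmeticHalf_classwide_sharp`) exports the sharp pair with (E1) in `↔` form and (E2), both BEFORE the small-image datum, and
without (E3) `∀ cK, cK • 𝔪 = 𝔪` (its modulus `∏ 𝔭_w^{e_w+1}` has the non-symmetric exponents of an arbitrary module of definition). The LEAD's glue′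
`SmallImageRttCharRoad.psbTheta_of_charRoad_sharp` (p830493) was written against the contract of BRIEF-SHARP §1: the three partner properties
(E1) FORWARD, (E2), (E3) appended AT THE END of the innermost body. This file delivers EXACTLY that contract, by re-sharpening with ONE uniform exponent
(`IsGrossencharakter.exists_sharp_uniform`: `𝔪 = (∏_{w ∈ ram ω} 𝔭_w)^{N+1}`-shaped, so support-stability ⇒ ideal-stability) and deriving the
support-stability from CM-reality (`le_smul_asIdeal_iff_of_sharp`, p830524: `ω ∘ c = \bar ω` by multiplicity one). The clauses `hneb`, (dK′) are the
theorems `nebentypus_of_sharp`, `le_asIdeal_of_discr_mem` of producer′.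

* ★★ `exists_arithmeticHalf_classwide_sharp₃` — conclusion of `exists_arithmeticHalf_classwide` VERBATIM for the uniformly sharpened pair, with,
  appended after `hKU` (the last conjunct of the small-image datum): (E1) `∀ χ, (∀ᶠ v, χ(ϖ_v) = ψ v) → ∀ w, 𝔪 ≤ w.asIdeal → ¬ χ.IsUnramifiedAt w`,
  (E2) `∀ w, ↑d_K ∈ w.asIdeal → 𝔪 ≤ w.asIdeal`, (E3) `∀ cK : K ≃ₐ[ℚ] K, cK • 𝔪 = 𝔪`.

References: [NeukirchANT1999] Ch. VII §6 (6.11)–(6.14); [Ribet1977Nebentypus] §3; [Weil1956] §1; [Serre1972] §2.2 Prop. 14, §4.2 c), §5.2 (iv).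
-/

set_option autoImplicit false
set_option linter.dupNamespace false
noncomputable section

open scoped Classical NumberField MatrixGroups nonZeroDivisors ComplexConjugate Pointwise
open IsDedekindDomain IsDedekindDomain.HeightOneSpectrum Field Matrix NumberField WeierstrassCurve Filter
  Literature.NumberTheory.EllipticCurves Literature.NumberTheory.GaloisRepresentations Rat.HeightOneSpectrum
  Literature.NumberTheory.EllipticCurves.Rank1Residual Summit.BirchSwinnertonDyer.Rank1Residual
  Literature.NumberTheory.LFunctions Literature.NumberTheory.GaloisRepresentations.HeckeCharacter
  Literature.NumberTheory.GaloisRepresentations.IsNonarchimedeanLocalField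
  Literature.NumberTheory.GaloisRepresentations.ModPGaloisRep ValuativeRel
  Literature.NumberTheory.EllipticCurves.ModularForms Literature.NumberTheory.Automorphic
  Summit.BirchSwinnertonDyer.BirchSwinnertonDyer.Theorems.HeckeThetaPartner

namespace Summit.BirchSwinnertonDyer.BirchSwinnertonDyer.Theorems.SmallImageLambdaLowerThreeNsThetaPartner

/-- ★★ **The arithmetic half with a SHARP, `Aut(K/ℚ)`-STABLE modulus — the export contract of RULING «SHARP-1» §1 verbatim.** The conclusion of
`exists_arithmeticHalf_classwide` (binders `K σ 𝔪 ψ e`, clauses `hK2 htc h𝔪 hnop hpD hbad hψG hneb htrace hv hpd hdK`, datum `Φ k e₀ he₀ hk h2 htr hGN hUle hKU`)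
for a SHARP pair `(𝔪, ψ)` whose modulus has ONE uniform exponent, with THREE conjuncts appended AFTER `hKU`: (E1) `hprim` — every idelic realisation of `ψ`
is ramified at the primes of `𝔪` (forward form); (E2) `hdK` — every prime of `d_K` divides `𝔪`; (E3) `h𝔪c` — `cK • 𝔪 = 𝔪` for every `cK : K ≃ₐ[ℚ] K`
(support-stability from CM-reality, `le_smul_asIdeal_iff_of_sharp`; ideal-stability by the uniform exponent). Destructure:
`⟨K, _, _, σK, 𝔪, ψ, e, hK2, htc, h𝔪, hnop, hpD, hbad, hψG, hneb, htrace, hv, hpd, hdK, Φ, k, e₀, he₀, hk, h2, htr, hGN, hUle, hKU, hprim, hdKle, h𝔪c⟩`.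
[cite: Serre1972, §2.2 Prop. 14, §4.2 c), §5.2 (iv)] [cite: Ribet1977Nebentypus, §3 Thm. 3.6] [cite: NeukirchANT1999, Ch. VII §6 (6.11)–(6.14)] [cite: Weil1956, §1] -/
theorem exists_arithmeticHalf_classwide_sharp₃ (W : WeierstrassCurve ℚ) [W.IsElliptic] [W.IsGloballyMinimal] (p : ℕ) [Fact p.Prime]
    (hp2 : p ≠ 2) (hX : ClassX7 W p) (hs : ¬ Surj W p) :
    ∃ (K : Type) (_ : Field K) (_ : NumberField K) (σ : K →+* ℂ) (𝔪 : Ideal (𝓞 K))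
      (ψ : HeightOneSpectrum (𝓞 K) → ℂ) (e : PadicAlgCl p ≃+* ℂ),
      Module.finrank ℚ K = 2 ∧ IsTotallyComplex K ∧ 𝔪 ≠ ⊥ ∧
      (∀ I : Ideal (𝓞 K), Ideal.absNorm I ≠ p) ∧ ¬ p ∣ (NumberField.discr K).natAbs * Ideal.absNorm 𝔪 ∧
      (∀ (ℓ : ℕ) [Fact ℓ.Prime], ℓ ∣ (NumberField.discr K).natAbs * Ideal.absNorm 𝔪 → ¬ W.HasGoodReductionAtPrime ℓ) ∧
      IsGrossencharakter 𝔪 (embType σ) (embTypeConj σ) ψ ∧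
      (∀ n : ℕ, Odd n → n.Coprime ((NumberField.discr K).natAbs * Ideal.absNorm 𝔪) →
        idealPow K ψ (Ideal.span {(n : 𝓞 K)}) = (jacobiSym (NumberField.discr K) n : ℂ) * (n : ℂ) ^ (2 - 1)) ∧
      (∀ (ℓ : ℕ) [Fact ℓ.Prime], ℓ ≠ p → W.HasGoodReductionAtPrime ℓ →
        ‖e.symm (∑ᶠ (w : HeightOneSpectrum (𝓞 K)) (_ : Ideal.absNorm w.asIdeal = ℓ), ψ w) -
          (W.frobeniusTrace ℓ : PadicAlgCl p)‖ < 1) ∧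
      (∃ v : HeightOneSpectrum (𝓞 K), v.asIdeal = Ideal.span {(p : 𝓞 K)} ∧ Nat.card (𝓞 K ⧸ v.asIdeal) = p ^ 2) ∧
      ¬ (p : ℤ) ∣ NumberField.discr K ∧
      (∀ (ℓ : ℕ) [Fact ℓ.Prime], (ℓ : ℤ) ∣ NumberField.discr K → ¬ W.HasGoodReductionAtPrime ℓ) ∧
      ∃ (Φ : Multiplicative (AddAut (geomTorsion W p)) ≃* GL (Fin 2) (ZMod p))
        (k : Subalgebra (ZMod p) (Matrix (Fin 2) (Fin 2) (ZMod p))) (e₀ : geomTorsion W p ≃+ (Fin 2 → ZMod p)),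
        (∀ (g : Multiplicative (AddAut (geomTorsion W p))) (x : geomTorsion W p),
          e₀ (Multiplicative.toAdd g x) = ((Φ g : GL (Fin 2) (ZMod p)) : Matrix (Fin 2) (Fin 2) (ZMod p)) *ᵥ e₀ x) ∧
        IsField k ∧ Module.finrank (ZMod p) k = 2 ∧
        (letI : Module (ZMod p) (geomTorsion W p) := AddSubgroup.torsionBy.zmodModule
          ∀ g : Multiplicative (AddAut (geomTorsion W p)),
            Matrix.trace ((Φ g : GL (Fin 2) (ZMod p)) : Matrix (Fin 2) (Fin 2) (ZMod p)) =
              LinearMap.trace (ZMod p) (geomTorsion W p) ((Multiplicative.toAdd g).toAddMonoidHom.toZModLinearMap p)) ∧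
        (galoisRepTorsion W p).range.map Φ.toMonoidHom ≤
          Subgroup.normalizer (Serre1972.unitGroup k : Set (GL (Fin 2) (ZMod p))) ∧
        ((Serre1972.unitGroup k).comap Φ.toMonoidHom).comap (galoisRepTorsion W p) ≤
          (absGaloisRestrict ℚ K).toMonoidHom.range ∧
        (∀ τ : absoluteGaloisGroup K, Φ (galoisRepTorsion W p (absGaloisRestrict ℚ K τ)) ∈ Serre1972.unitGroup k) ∧
        -- (E1) SHARP SUPPORT, forward form: every idelic realisation of `ψ` is ramified at the primes of `𝔪`
        (∀ χ : Literature.NumberTheory.GaloisRepresentations.HeckeCharacter K,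
          (∀ᶠ v in Filter.cofinite, χ.valueAtUniformizer v = ψ v) →
          ∀ w : IsDedekindDomain.HeightOneSpectrum (𝓞 K), 𝔪 ≤ w.asIdeal → ¬ χ.IsUnramifiedAt w) ∧
        -- (E2) every ramified prime of `K` divides `𝔪`
        (∀ w : IsDedekindDomain.HeightOneSpectrum (𝓞 K), ((NumberField.discr K : ℤ) : 𝓞 K) ∈ w.asIdeal → 𝔪 ≤ w.asIdeal) ∧
        -- (E3) `𝔪` is stable under `Aut(K/ℚ)`
        (∀ cK : K ≃ₐ[ℚ] K, cK • 𝔪 = 𝔪) := by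
  classical
  have hp : p.Prime := Fact.out
  obtain ⟨K, _, _, σ, 𝔪, ψ, e, hK2, htc, h𝔪, hnop, hpD, hbad, hψG, hneb, htrace, hv, hpd, hdK, Φ, k, e₀, he₀, hk, h2, htr,
    hGN, hUle, hKU⟩ := exists_arithmeticHalf_classwide W p hp2 hX hs
  haveI : IsTotallyComplex K := htc
  -- sharpen the modulus with one uniform exponent
  obtain ⟨𝔪', ψ', h𝔪', hsupp, hnorm, hψ'G, heq, hsharp, hstable⟩ := hψG.exists_sharp_uniform h𝔪
  have hdiv : ∀ ℓ : ℕ, ℓ.Prime → ℓ ∣ (NumberField.discr K).natAbs * Ideal.absNorm 𝔪' →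
      ℓ ∣ (NumberField.discr K).natAbs * Ideal.absNorm 𝔪 := by
    intro ℓ hℓ h
    rcases (Nat.Prime.dvd_mul hℓ).mp h with h1 | h1
    · exact h1.mul_right _
    · exact (hnorm ℓ hℓ h1).mul_left _
  have hpD' : ¬ p ∣ (NumberField.discr K).natAbs * Ideal.absNorm 𝔪' := fun h => hpD (hdiv p hp h)
  have hbad' : ∀ (ℓ : ℕ) [Fact ℓ.Prime], ℓ ∣ (NumberField.discr K).natAbs * Ideal.absNorm 𝔪' →
      ¬ W.HasGoodReductionAtPrime ℓ := fun ℓ _ h => hbad ℓ (hdiv ℓ Fact.out h)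
  have hneb' := nebentypus_of_sharp hK2 σ h𝔪 h𝔪' hψ'G heq hneb
  have htrace' : ∀ (ℓ : ℕ) [Fact ℓ.Prime], ℓ ≠ p → W.HasGoodReductionAtPrime ℓ →
      ‖e.symm (∑ᶠ (w : HeightOneSpectrum (𝓞 K)) (_ : Ideal.absNorm w.asIdeal = ℓ), ψ' w) -
        (W.frobeniusTrace ℓ : PadicAlgCl p)‖ < 1 := by
    intro ℓ _ hℓp hgood
    have hcongr : (∑ᶠ (w : HeightOneSpectrum (𝓞 K)) (_ : Ideal.absNorm w.asIdeal = ℓ), ψ' w) =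
        ∑ᶠ (w : HeightOneSpectrum (𝓞 K)) (_ : Ideal.absNorm w.asIdeal = ℓ), ψ w := by
      refine finsum_congr fun w => finsum_congr fun hw => heq w fun hle => ?_
      have h1 : ℓ ∣ Ideal.absNorm 𝔪 := hw ▸ Ideal.absNorm_dvd_absNorm_of_le hle
      exact hbad ℓ (h1.mul_left _) hgood
    rw [hcongr]
    exact htrace ℓ hℓp hgood
  -- (E3): support-stability from CM-reality, ideal-stability from the uniform exponent
  have h𝔪c : ∀ cK : K ≃ₐ[ℚ] K, cK • 𝔪' = 𝔪' := fun cK =>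
    hstable cK fun w => le_smul_asIdeal_iff_of_sharp hK2 σ cK h𝔪' hψ'G hneb' hsharp w
  exact ⟨K, inferInstance, inferInstance, σ, 𝔪', ψ', e, hK2, htc, h𝔪', hnop, hpD', (fun ℓ _ h => hbad' ℓ h), hψ'G, hneb',
    (fun ℓ _ hℓp hgood => htrace' ℓ hℓp hgood), hv, hpd, hdK, Φ, k, e₀, he₀, hk, h2, htr, hGN, hUle, hKU,
    (fun χ hχ w hw => (hsharp χ hχ w).mp hw), (fun w hw => le_asIdeal_of_discr_mem hK2 σ h𝔪' hψ'G hneb' hw), h𝔪c⟩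

end Summit.BirchSwinnertonDyer.BirchSwinnertonDyer.Theorems.SmallImageLambdaLowerThreeNsThetaPartner

end
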